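import Literature.AnabelianGeometry.EtaleTheta.ThetaProperFractionPairSmallIndex
import Literature.AnabelianGeometry.EtaleTheta.Discharge.Sec5JunctionSmallIndexHypotheses
import HarnessLib

/-!
# [EtTh] §5 p.330 at the Ÿ-ANCHOR of the junction carrier of record: the theta function `Θ̈ ∈ O^×(A_⊙^birat)`, `A_⊙ = (Compat₃′/φ(ιX(Π^tp_Ÿ)), 0)`,
# and its Def. 4.1 (i) fraction-pair IN abc-iut-L2-t3's `settingSmallYdd`, under the single display clause «`φ₃ ∘ φ ∘ ιX = 1` on `Π^tp_Ÿ`»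

S. Mochizuki, *The étale theta function …*, Publ. RIMS **45** (2009) [MochizukiEtTh2009], §5 p.330 (PDF p.104) («the theta function determines an
element of `O^×(A_⊙^birat)`»; `A_⊙^bs` the object defined by the trivial line bundle over `Ÿ^log`), Def. 4.1 (i) p.312 (PDF p.86), Prop. 1.4
(i)(ii) pp.247–248 (PDF pp.21–22) (`Θ̈ ∈ K_Ÿ`: the translations `Gal(Y/X)` do NOT fix `Θ̈`).  [cite: MochizukiEtTh2009, §5 p.330 (PDF p.104)]
PAGE CONVENTION for [EtTh]: «printed N (PDF p.M)», N = M + 226.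

CLASS (b) DATUM (two definitions + theorems; abc-iut cell, layer L2, seat abc-iut-L2-d2 gen 8; plan/L2/SUBDAG-EtTh-JUNCTION.md slot D5 at the
carrier of record, abc-iut-L2-lead R1344; the `Ÿ`-specialisation of FILE D2 `ThetaProperFractionPairSmallIndex` (p512057) for abc-iut-L2-t4's
junction FILE 2).  Consumed BY NAME, nothing restated: D2's `thetaProperUnitQuot` / `thetaProperFractionPairQuot` / `translationFree_repr_quotConnObj`,
abc-iut-L2-t3's `settingSmallYdd` (p504077; `= settingSmall … (yddImage …)` definitionally), `yddImage` / `mem_yddImage_iff` (p496572).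
* `φ₃_eq_one_of_mem_yddImage` — the display clause `hY : ∀ y ∈ Π^tp_Ÿ, φ₃ (φ (ιX y)) = 1` IS «`M_Y = φ(ιX(Π^tp_Ÿ)) ≤ Ker φ₃`»;
* **`thetaProperUnitYdd`** `: O^×(A_⊙^birat)` and **`thetaProperFractionPairYdd`** `: (settingSmallYdd R S X φ hφ NH T ιX).FractionPair …` —
  D2's datum read at `M := yddImage` (nothing new; `rfl` lemmas `…_eq_quot`).
WHY THE CLAUSE IS NEEDED (honest, from D1/p509439): `Θ̈` is a function on `Ÿ`, moved by every translation (Prop. 1.4 (ii)); it descends to the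
covering `Compat₃′/M_Y` of the model exactly when `M_Y` is translation-free — for the genuine `φ = ((κ_ϖ,κ_Ü,κ_Θ̈), χ, γ)` this holds because
`Π^tp_Ÿ ≤ Π^tp_Y = Ker γ`; for the design-only onto-socket it is a HYPOTHESIS on `φ`.  HONEST FRAMING: class-(b) combinatorial DESIGN carrier
(NOT the tempered Frobenioid of a Tate curve); onto-socket design-only (R1257); no Prop-valued fact, no instance, no notation, no sorry; nothing here
bears on [IUTchIII] Cor. 3.12; no side taken; typed ≠ proved.
-/

noncomputable section

namespace Literature.AnabelianGeometry.EtaleTheta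

open CategoryTheory Opposite Function Literature.AlgebraicGeometry.Frobenioids Literature.AlgebraicGeometry.Frobenioids.QuasiTemperoid
  Literature.AnabelianGeometry.SemiGraphs LogDivisorModel LogDivisorModel.GaloisAction LogDivisorTower TateTowerKummerTwistRShear
  LogDivisorModel.TateTowerThetaTwist

namespace ThetaTwistTowerSmallIndex

open ThetaTwistTowerTempered

variable (R S : ((ConnectedPart (BTemp (Compat 3 thetaShear)))ᵒᵖ ⥤ CommMonCat.{0}) → Prop)
  {K : Type} [Field K] (X : SemiGraphs.TemperedArithmeticGroup.{0} K) (φ : X.Pi →ₜ* Compat 3 thetaShear) (hφ : Function.Surjective φ)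
  (NH : Subgroup (Field.absoluteGaloisGroup K) → (temperedFrobenioidSmall R S).category → ℕ+ → Prop)
  {N : ℕ+} (T : ThetaEnvData.{0} N) (ιX : T.PiX ≃ₜ* X.Pi) (hY : ∀ y : T.PiX, y ∈ T.PiYdd → φ₃ (φ (ιX y)) = 1)

include hY in
/-- **The display clause IS «`M_Y ≤ Ker φ₃`»**: every element of `φ(ιX(Π^tp_Ÿ))` is translation-free. [cite: MochizukiEtTh2009, §5 p.330 (PDF p.104)] -/
theorem φ₃_eq_one_of_mem_yddImage (g : Compat 3 thetaShear)
    (hg : g ∈ (BiKummerSetting.yddImage X φ hφ T ιX (isOpen_yddImage_compat₃ X φ hφ T ιX)).toSubgroup) : φ₃ g = 1 := by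
  obtain ⟨y, hy, rfl⟩ := (BiKummerSetting.mem_yddImage_iff X φ hφ T ιX _ g).1 hg
  exact hY y hy

/-- **`Θ̈ ∈ O^×(A_⊙^birat)` at the Ÿ-anchor `A_⊙ = (Compat₃′/φ(ιX(Π^tp_Ÿ)), 0)` of `settingSmallYdd`** (§5 p.330), under the display clause.
[cite: MochizukiEtTh2009, §5 p.330 (PDF p.104)] -/
def thetaProperUnitYdd : (temperedFrobenioidSmall R S).biratUnitsModel (settingSmallYdd R S X φ hφ NH T ιX).Aodot :=
  thetaProperUnitQuot R S _ (φ₃_eq_one_of_mem_yddImage X φ hφ T ιX hY)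

/-- It IS D2's `thetaProperUnitQuot` at `M := yddImage …` (definitionally). [cite: MochizukiEtTh2009, §5 p.330 (PDF p.104)] -/
theorem thetaProperUnitYdd_eq_quot : thetaProperUnitYdd R S X φ hφ NH T ιX hY =
    thetaProperUnitQuot R S (BiKummerSetting.yddImage X φ hφ T ιX (isOpen_yddImage_compat₃ X φ hφ T ιX))
      (φ₃_eq_one_of_mem_yddImage X φ hφ T ιX hY) := rfl

/-- **THE FRACTION-PAIR OF `Θ̈` IN `settingSmallYdd R S X φ hφ NH T ιX`** (Def. 4.1 (i); zero divisor ι(cusps^{N_m}), divisor of poles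
ι(`D₁`-family^{N_m}), disjoint supports proved in D2) — the D5 datum of the junction AT ITS CARRIER OF RECORD. [cite: MochizukiEtTh2009, Def 4.1 (i) p.86] -/
def thetaProperFractionPairYdd :
    (settingSmallYdd R S X φ hφ NH T ιX).FractionPair (A := (settingSmallYdd R S X φ hφ NH T ιX).Aodot) (thetaProperUnitYdd R S X φ hφ NH T ιX hY)
      (thetaProperCod R S (TemperedFrobenioid.quotConnObj isTempered_compat₃'
          (BiKummerSetting.yddImage X φ hφ T ιX (isOpen_yddImage_compat₃ X φ hφ T ιX)))
        (translationFree_repr_quotConnObj _ (φ₃_eq_one_of_mem_yddImage X φ hφ T ιX hY))) :=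
  thetaProperFractionPairQuot R S X NH φ hφ _ (φ₃_eq_one_of_mem_yddImage X φ hφ T ιX hY)

/-- It IS D2's `thetaProperFractionPairQuot` at `M := yddImage …` (definitionally). [cite: MochizukiEtTh2009, Def 4.1 (i) p.86] -/
theorem thetaProperFractionPairYdd_eq_quot : thetaProperFractionPairYdd R S X φ hφ NH T ιX hY =
    thetaProperFractionPairQuot R S X NH φ hφ (BiKummerSetting.yddImage X φ hφ T ιX (isOpen_yddImage_compat₃ X φ hφ T ιX))
      (φ₃_eq_one_of_mem_yddImage X φ hφ T ιX hY) := rfl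

/-- Its numerator pre-step. [cite: MochizukiEtTh2009, Def 4.1 (i) p.86] -/
theorem thetaProperFractionPairYdd_num : (thetaProperFractionPairYdd R S X φ hφ NH T ιX hY).num =
    thetaProperNum R S _ (translationFree_repr_quotConnObj _ (φ₃_eq_one_of_mem_yddImage X φ hφ T ιX hY)) := rfl

/-- Its denominator pre-step. [cite: MochizukiEtTh2009, Def 4.1 (i) p.86] -/
theorem thetaProperFractionPairYdd_den : (thetaProperFractionPairYdd R S X φ hφ NH T ιX hY).den =
    thetaProperDen R S _ (translationFree_repr_quotConnObj _ (φ₃_eq_one_of_mem_yddImage X φ hφ T ιX hY)) := rfl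

/-- **Non-vacuity in one line: at the carrier of record, under the display clause, the theta function with a Def. 4.1 (i) fraction-pair EXISTS**
(so abc-iut-L2-t3's `prop42_iii_settingSmallYdd`, when it lands, yields its roots). [cite: MochizukiEtTh2009, §5 p.330 (PDF p.104)] -/
theorem exists_thetaProper_fractionPair_settingSmallYdd (hY : ∀ y : T.PiX, y ∈ T.PiYdd → φ₃ (φ (ιX y)) = 1) :
    ∃ (θ : (temperedFrobenioidSmall R S).biratUnitsModel (settingSmallYdd R S X φ hφ NH T ιX).Aodot) (B : (settingSmallYdd R S X φ hφ NH T ιX).C),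
      Nonempty ((settingSmallYdd R S X φ hφ NH T ιX).FractionPair (A := (settingSmallYdd R S X φ hφ NH T ιX).Aodot) θ B) :=
  ⟨_, _, ⟨thetaProperFractionPairYdd R S X φ hφ NH T ιX hY⟩⟩

end ThetaTwistTowerSmallIndex

end Literature.AnabelianGeometry.EtaleTheta

end
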